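import Summits.QuantumFields.GaugeBoot.BesselCapRectangle
import HarnessLib

/-!
# Gauge-boot: the ONE-SIDED cap witness of the `R × T` rectangle word — one long side, every `R ≥ 1`, every `T`

Cell `ym-instrument` (HOME `run/shared/lean/pub/ym-instrument/`), crew (a), seat `ym-instrument-boot-lean-1` (gen 3);
A-plan-11 «BESSEL CAP» typing, successor of file 9 `GaugeBoot/BesselCapRectangle` (two-sided witness, `R ≥ 2`). It
answers boot-plan's question 2026-08-27T03:22:18Z (3) / ACT-D (T-a): the WIDTH-ONE column cap `λ₁ = ρ` of the capped
class-LIMIT files (`|W̄(t × 1)| ≤ ρ^t`) IS a cap instance — the witness is the `t` links of ONE long side.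

HONEST FRAMING (page 1 of every file of this cell): pure combinatorics of the rectangle word on `ℤ^d`; nothing is certified
about any lattice gauge theory at any `(G, D, L, β)`; nothing summit-bearing.

## Content

For `i ≠ j`, `R ≥ 1` and any `T`, the rectangle word `Word.rectangle i j R T` read from `0 ∈ ℤ^d` traverses each of the
`T` links of its far side in direction `j` (the column `{R eᵢ + s eⱼ}`, `s < T`) exactly once
(`BesselCapRectangle.count_rectangle_right`), no two of them share a plaquette (consecutive collinear links never do,
`ShareZ.apply_eq_of_snd_eq`), and all read links lie in the box `[0, R] × [0, T]`; hence
`capCheck (rectangle i j R T) (rightColumn i j R T) L₀ = true` for every `L₀ ≥ max(R, T) + 3` (`capCheck_rectangle_right`).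
With `BesselCapCheck.capCheck_sound` and the cap this gives `|⟨W̄(R×T)⟩| ≤ ρ^{T}` for EVERY `R ≥ 1` on every torus
`L ≥ max(R,T) + 3` (file `YangMills/Theorems/Instrument/BesselCapWidthOne`); for `R ≥ 2` the two-sided witness of file 9
gives the better `ρ^{2T}` — the one-sided witness is what survives at `R = 1`, where the two sides of the strip are at
distance `1` and DO share the strip's plaquettes (so `m(1 × T) = T = max(1, T)`, the value agreed boot-ref∕lean-1,
boot-plan AMEND A-plan-11 v2 §1).
-/

namespace Summit.QuantumFields.GaugeBoot

open Literature.MathematicalPhysics.QuantumFieldTheory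

variable {d : ℕ}

section Column

variable (i j : Fin d)

/-- The ONE-SIDED cap witness of the `R × T` rectangle: the `T` links `(R eᵢ + s eⱼ, j)`, `s < T`, of its far side in
direction `j`. [folklore] -/
def rightColumn (R T : ℕ) : List (EdgeZ d) := (List.range T).map (fun s : ℕ => (zvec i j R s, j))

/-- `|rightColumn| = T`. [folklore] -/
@[simp] theorem length_rightColumn (R T : ℕ) : (rightColumn i j R T).length = T := by
  simp [rightColumn]

variable {i j}

/-- **No two links of one column share a plaquette**: two links in direction `j` sharing a plaquette have the same
`j`-coordinate, hence (same column) coincide. [folklore] -/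
theorem not_shareZ_rightColumn (hij : i ≠ j) {R T : ℕ} {E E' : EdgeZ d} (hE : E ∈ rightColumn i j R T)
    (hE' : E' ∈ rightColumn i j R T) (hne : E ≠ E') : ¬ ShareZ E E' := by
  intro hsh
  unfold rightColumn at hE hE'
  obtain ⟨s, -, rfl⟩ := List.mem_map.1 hE
  obtain ⟨s', -, rfl⟩ := List.mem_map.1 hE'
  have hj := hsh.apply_eq_of_snd_eq rfl
  simp only [zvec_apply hij, Ne.symm hij, if_false, if_true] at hj
  have hss : s = s' := by exact_mod_cast hj
  subst hss
  exact hne rfl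

variable (i j)

/-- **THE CHECKER ACCEPTS THE ONE-SIDED WITNESS**: for `i ≠ j`, `R ≥ 1`, any `T`, and `L₀ ≥ max(R, T) + 3`,
`capCheck (rectangle i j R T) (rightColumn i j R T) L₀ = true`. [folklore] -/
theorem capCheck_rectangle_right (hij : i ≠ j) {R T L₀ : ℕ} (hR : 1 ≤ R) (hRL : R + 3 ≤ L₀) (hTL : T + 3 ≤ L₀) :
    capCheck (Word.rectangle i j R T) (rightColumn i j R T) L₀ = true := by
  have hnd : (rightColumn i j R T).Nodup := nodup_map_range_zvec hij T R j Nat.cast_injective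
  have hcnt : ∀ E ∈ rightColumn i j R T, (Word.edgesReadZ 0 (Word.rectangle i j R T)).count E = 1 := by
    intro E hE
    unfold rightColumn at hE
    simp only [List.mem_map, List.mem_range] at hE
    obtain ⟨s, hs, rfl⟩ := hE
    exact count_rectangle_right hij hR hs
  have hsh : ∀ E ∈ rightColumn i j R T, ∀ E' ∈ rightColumn i j R T, E ≠ E' → ¬ ShareZ E E' :=
    fun E hE E' hE' hne => not_shareZ_rightColumn hij hE hE' hne
  have hsp := spreadOK_rectangle hij hRL hTL (R := R) (T := T)
  have h2 : 2 ≤ L₀ := by omega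
  simp only [capCheck, Bool.and_eq_true, decide_eq_true_eq]
  exact ⟨⟨⟨⟨h2, hnd⟩, hcnt⟩, hsh⟩, hsp⟩

end Column

end Summit.QuantumFields.GaugeBoot
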